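import Summits.CriticalPhenomena.PercolationContinuityZ3.Theorems.PercNearOneGluingNoHeavyLowerTailSahiGridPatternRoundingMin

/-!
# `NoHeavyLowerTail` (crux stmt-CriticalPhenomena-4575), Sahi programme P1: the rounding calculus, part 8 —
# **F1-EXTREMALITY OF LEXICOGRAPHIC MINIMISERS**: at a lex-minimiser every addable cell of `A` lies in `B ∩ C`

Support file (seat `prim-sahi-p1`, generation 13; `--supports stmt-CriticalPhenomena-4575`).  Pure proofs; bookkeeping definitions `lowerOn`
(lower a point to the low level on a set of axes) and `lowerOrbit` (the orbit of an addable cell under the value swaps of the resolved axes);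
no `sorry`, standard axioms.  Vocabulary of `…RoundingMin` (`IsLexMin`, `unresCount`) and `…Rounding` (`axSwap`, `AxInv`, `Resolved`).

THE MATHEMATICS (the 'off-meet addition' move of Lieb–Sahi's extremal argument, made compatible with the resolved axes).  Let `(A,B,C)` be a
lexicographic minimiser (`IsLexMin`: `sStarD` minimal, then fewest unresolved axes, then maximal total size) and let `x ∉ A` be ADDABLE
(`insert x A` is an up-set).  Adding `x` alone lowers the functional weakly when `x ∉ B ∩ C` (`yProfile_nonpos_of_not_mem`) but may un-resolve a
resolved axis.  Instead add the whole ORBIT of `x` under the value swaps `(lo hi)` of the resolved axes `b` (for each resolved `b` fix a pair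
`j_b` at which all three sets are invariant; `x_b ≠ lo_b` by addability, and the orbit is `{x lowered to lo_b on T : T ⊆ L}`,
`L = {b resolved : x_b = hi_b}`): the union `A ∪ orbit` is again an up-set (`isUpperSet_union_lowerOrbit`), is invariant on every resolved axis
(so no axis becomes unresolved, `unresCount_union_lowerOrbit_le`), every orbit point lies outside `B ∩ C` when `x` does (invariance of `B ∩ C`),
so the functional does not increase — contradicting maximality of the size.  Hence **`IsLexMin.mem_inter_of_insert`**: at a lex-minimiser,
every addable cell of `A` lies in `B ∩ C` (and symmetrically for `B`, `C` by the slot symmetries — not restated).  Together with part 7 this is the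
full first-order extremal structure available to a proof of `RoundingAlternativeMin d`.
HONEST LABEL: structure lemmas only; `RoundingAlternativeMin d`, `PatternPos d` (`d ≥ 4`), Kahn's Conjecture 5, Sahi's `C₃` remain OPEN. [this work]
-/

namespace Summit.CriticalPhenomena.PercolationContinuityZ3.Theorems.SahiGridPattern

open Finset
open scoped Classical

variable {d : ℕ}

/-! ### Lowering a point on a set of axes -/

/-- Lower `x` to the level `lo (j b)` on every axis `b ∈ T`. [this work] -/
def lowerOn (j : Fin d → Fin 2) (T : Finset (Fin d)) (x : Pd d) : Pd d := fun b => if b ∈ T then lo (j b) else x b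

/-- Coordinates of a lowered point. [this work] -/
theorem lowerOn_apply (j : Fin d → Fin 2) (T : Finset (Fin d)) (x : Pd d) (b : Fin d) :
    lowerOn j T x b = if b ∈ T then lo (j b) else x b := rfl

/-- Lowering on the empty set does nothing. [this work] -/
theorem lowerOn_empty (j : Fin d → Fin 2) (x : Pd d) : lowerOn j ∅ x = x := by
  funext b; simp [lowerOn_apply]

/-- Lowering on `insert b T` is the value swap on `b` after lowering on `T`, when `x_b = hi (j b)` and `b ∉ T`. [this work] -/
theorem lowerOn_insert {j : Fin d → Fin 2} {T : Finset (Fin d)} {x : Pd d} {b : Fin d} (hb : b ∉ T) (hxb : x b = hi (j b)) :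
    lowerOn j (insert b T) x = axSwap b (lo (j b)) (hi (j b)) (lowerOn j T x) := by
  have h1 : lowerOn j T x b = hi (j b) := by rw [lowerOn_apply, if_neg hb, hxb]
  rw [axSwap_eq_update_of_eq_right h1]
  funext c
  by_cases hc : c = b
  · subst hc; rw [Function.update_self, lowerOn_apply, if_pos (mem_insert_self c T)]
  · rw [Function.update_of_ne hc, lowerOn_apply, lowerOn_apply]
    simp only [mem_insert, hc, false_or]

/-- A set invariant under the value swaps of all axes of `T` (at levels `j`) contains `x` iff it contains `lowerOn j T x`, provided
`x_b = hi (j b)` on `T`. [this work] -/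
theorem mem_iff_lowerOn_mem {j : Fin d → Fin 2} {X : Finset (Pd d)} (T : Finset (Fin d))
    (hinv : ∀ b ∈ T, AxInv b (lo (j b)) (hi (j b)) X) {x : Pd d} (hx : ∀ b ∈ T, x b = hi (j b)) :
    x ∈ X ↔ lowerOn j T x ∈ X := by
  induction T using Finset.induction_on with
  | empty => rw [lowerOn_empty]
  | insert b T hb ih =>
    rw [lowerOn_insert hb (hx b (mem_insert_self b T)),
      ← hinv b (mem_insert_self b T) (lowerOn j T x)]
    exact ih (fun c hc => hinv c (mem_insert_of_mem hc)) (fun c hc => hx c (mem_insert_of_mem hc))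

/-- Lowering is below the point. [this work] -/
theorem lowerOn_le {j : Fin d → Fin 2} (T : Finset (Fin d)) {x : Pd d} (hx : ∀ b ∈ T, x b = hi (j b)) : lowerOn j T x ≤ x := by
  intro b
  rw [lowerOn_apply]
  split_ifs with hb
  · rw [hx b hb]; exact (lo_lt_hi (j b)).le
  · exact le_rfl

/-- Lowering is injective in the axis set (inside a set of axes where `x` sits at the high level). [this work] -/
theorem lowerOn_injOn {j : Fin d → Fin 2} {L : Finset (Fin d)} {x : Pd d} (hx : ∀ b ∈ L, x b = hi (j b)) :
    Set.InjOn (fun T => lowerOn j T x) (L.powerset : Set (Finset (Fin d))) := by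
  intro T hT T' hT' h
  rw [Finset.mem_coe, mem_powerset] at hT hT'
  ext b
  have hb := congrFun h b
  simp only [lowerOn_apply] at hb
  constructor
  · intro hbT
    by_contra hbT'
    rw [if_pos hbT, if_neg hbT', hx b (hT hbT)] at hb
    exact absurd hb (lo_ne_hi (j b))
  · intro hbT'
    by_contra hbT
    rw [if_neg hbT, if_pos hbT', hx b (hT' hbT')] at hb
    exact absurd hb.symm (lo_ne_hi (j b))

/-! ### The orbit of an addable cell and the augmented set -/

/-- The orbit `{lowerOn j T x : T ⊆ L}`. [this work] -/
def lowerOrbit (j : Fin d → Fin 2) (L : Finset (Fin d)) (x : Pd d) : Finset (Pd d) := L.powerset.image fun T => lowerOn j T x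

/-- `x` itself is in its orbit. [this work] -/
theorem self_mem_lowerOrbit (j : Fin d → Fin 2) (L : Finset (Fin d)) (x : Pd d) : x ∈ lowerOrbit j L x :=
  mem_image.2 ⟨∅, by simp, lowerOn_empty j x⟩

/-- Membership in the orbit. [this work] -/
theorem mem_lowerOrbit {j : Fin d → Fin 2} {L : Finset (Fin d)} {x y : Pd d} :
    y ∈ lowerOrbit j L x ↔ ∃ T, T ⊆ L ∧ lowerOn j T x = y := by
  unfold lowerOrbit; simp only [mem_image, mem_powerset]

/-- The orbit has `2^|L|` elements. [this work] -/
theorem card_lowerOrbit {j : Fin d → Fin 2} {L : Finset (Fin d)} {x : Pd d} (hx : ∀ b ∈ L, x b = hi (j b)) :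
    (lowerOrbit j L x).card = 2 ^ L.card := by
  unfold lowerOrbit
  rw [card_image_of_injOn (lowerOn_injOn hx), card_powerset]

/-- If `x ∉ A` and `A` is invariant on the axes of `L`, the orbit misses `A`. [this work] -/
theorem disjoint_lowerOrbit {j : Fin d → Fin 2} {L : Finset (Fin d)} {x : Pd d} {A : Finset (Pd d)} (hxA : x ∉ A)
    (hinv : ∀ b ∈ L, AxInv b (lo (j b)) (hi (j b)) A) (hx : ∀ b ∈ L, x b = hi (j b)) : Disjoint A (lowerOrbit j L x) := by
  rw [Finset.disjoint_right]
  intro y hy hyA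
  obtain ⟨T, hTL, rfl⟩ := mem_lowerOrbit.1 hy
  exact hxA ((mem_iff_lowerOn_mem T (fun b hb => hinv b (hTL hb)) (fun b hb => hx b (hTL hb))).2 hyA)

/-- **The augmented set `A ∪ orbit` is an up-set** when `x` is addable to the up-set `A` and `A` is invariant on the axes of `L`. [this work] -/
theorem isUpperSet_union_lowerOrbit {j : Fin d → Fin 2} {L : Finset (Fin d)} {x : Pd d} {A : Finset (Pd d)}
    (hA : IsUpperSet (A : Set (Pd d))) (hadd : IsUpperSet ((insert x A : Finset (Pd d)) : Set (Pd d)))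
    (hinv : ∀ b ∈ L, AxInv b (lo (j b)) (hi (j b)) A) (hx : ∀ b ∈ L, x b = hi (j b)) :
    IsUpperSet ((A ∪ lowerOrbit j L x : Finset (Pd d)) : Set (Pd d)) := by
  intro y z hyz hy
  rw [Finset.mem_coe, mem_union] at hy ⊢
  rcases hy with hyA | hyO
  · exact Or.inl (hA hyz hyA)
  obtain ⟨T, hTL, rfl⟩ := mem_lowerOrbit.1 hyO
  -- raise `z` back to `hi` on the axes of `T` where it sits strictly below `hi`
  set T'' : Finset (Fin d) := T.filter fun b => z b < hi (j b) with hT''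
  have hT''T : T'' ⊆ T := filter_subset _ _
  have hzlo : ∀ b ∈ T'', z b = lo (j b) := by
    intro b hb
    obtain ⟨hbT, hblt⟩ := mem_filter.1 hb
    have h1 : lo (j b) ≤ z b := by
      have := hyz b; rw [lowerOn_apply, if_pos hbT] at this; exact this
    exact le_antisymm (le_lo_of_lt_hi hblt) h1
  -- the raised point
  let zup : Pd d := fun b => if b ∈ T'' then hi (j b) else z b
  have hzup_ge : x ≤ zup := by
    intro b
    show x b ≤ (if b ∈ T'' then hi (j b) else z b)
    by_cases hb'' : b ∈ T''
    · rw [if_pos hb'', hx b (hTL (hT''T hb''))]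
    · rw [if_neg hb'']
      by_cases hbT : b ∈ T
      · have hnot : ¬ z b < hi (j b) := fun hlt => hb'' (mem_filter.2 ⟨hbT, hlt⟩)
        rw [hx b (hTL hbT)]; exact not_lt.1 hnot
      · have := hyz b; rw [lowerOn_apply, if_neg hbT] at this; exact this
  have hz_eq : z = lowerOn j T'' zup := by
    funext b
    rw [lowerOn_apply]
    by_cases hb'' : b ∈ T''
    · rw [if_pos hb'', hzlo b hb'']
    · rw [if_neg hb'']; show z b = (if b ∈ T'' then hi (j b) else z b); rw [if_neg hb'']
  have hzup_hi : ∀ b ∈ T'', zup b = hi (j b) := fun b hb => by show (if b ∈ T'' then hi (j b) else z b) = _; rw [if_pos hb]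
  by_cases hzx : zup = x
  · -- then `z` is an orbit point
    right
    rw [hz_eq, hzx]
    exact mem_lowerOrbit.2 ⟨T'', hT''T.trans hTL, rfl⟩
  · -- then `zup > x` lies in `A`, and so does `z` by invariance
    left
    have hzupA : zup ∈ A := by
      have hmem : zup ∈ insert x A := hadd hzup_ge (by rw [Finset.mem_coe]; exact mem_insert_self x A)
      rcases mem_insert.1 hmem with h | h
      · exact absurd h hzx
      · exact h
    rw [hz_eq]
    exact (mem_iff_lowerOn_mem T'' (fun b hb => hinv b (hTL (hT''T hb))) hzup_hi).1 hzupA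

/-- The orbit is invariant under the value swap of every axis `b` that is either in `L` or on which `x` avoids both levels. [this work] -/
theorem axInv_lowerOrbit {j : Fin d → Fin 2} {L : Finset (Fin d)} {x : Pd d} (hx : ∀ b ∈ L, x b = hi (j b)) (b : Fin d)
    (hb : b ∈ L ∨ (x b ≠ lo (j b) ∧ x b ≠ hi (j b))) : AxInv b (lo (j b)) (hi (j b)) (lowerOrbit j L x) := by
  -- it suffices to show the orbit is closed under the swap (the swap is an involution)
  suffices key : ∀ y ∈ lowerOrbit j L x, axSwap b (lo (j b)) (hi (j b)) y ∈ lowerOrbit j L x by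
    intro y
    constructor
    · exact key y
    · intro h; have := key _ h; rwa [axSwap_axSwap] at this
  intro y hy
  obtain ⟨T, hTL, rfl⟩ := mem_lowerOrbit.1 hy
  rcases hb with hbL | ⟨hlo, hhi⟩
  · by_cases hbT : b ∈ T
    · -- swapping raises coordinate `b` back: the orbit point of `T.erase b`
      refine mem_lowerOrbit.2 ⟨T.erase b, (erase_subset b T).trans hTL, ?_⟩
      have hbe : b ∉ T.erase b := fun h => (mem_erase.1 h).1 rfl
      have : lowerOn j T x = axSwap b (lo (j b)) (hi (j b)) (lowerOn j (T.erase b) x) := by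
        rw [← lowerOn_insert hbe (hx b hbL), insert_erase hbT]
      rw [this, axSwap_axSwap]
    · -- swapping lowers coordinate `b`: the orbit point of `insert b T`
      refine mem_lowerOrbit.2 ⟨insert b T, insert_subset hbL hTL, ?_⟩
      rw [lowerOn_insert hbT (hx b hbL)]
  · have hbT : b ∉ T := fun h => hhi (hx b (hTL h))
    have h1 : lowerOn j T x b = x b := by rw [lowerOn_apply, if_neg hbT]
    rw [axSwap_eq_self (by rw [h1]; exact hlo) (by rw [h1]; exact hhi)]
    exact hy

/-- Unions of invariant sets are invariant. [this work] -/
theorem axInv_union {a : Fin d} {u v : Fin 3} {X Y : Finset (Pd d)} (hX : AxInv a u v X) (hY : AxInv a u v Y) : AxInv a u v (X ∪ Y) := by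
  intro x; rw [mem_union, mem_union, hX x, hY x]

/-- Intersections of invariant sets are invariant. [this work] -/
theorem axInv_inter {a : Fin d} {u v : Fin 3} {X Y : Finset (Pd d)} (hX : AxInv a u v X) (hY : AxInv a u v Y) : AxInv a u v (X ∩ Y) := by
  intro x; rw [mem_inter, mem_inter, hX x, hY x]

/-- `sStarD` is additive in the first slot over a disjoint union. [this work] -/
theorem sStarD_union_first {X Y : Finset (Pd d)} (h : Disjoint X Y) (B C : Finset (Pd d)) :
    sStarD (X ∪ Y) B C = sStarD X B C + sStarD Y B C := by
  rw [sStarD_eq_sum_tcD, sStarD_eq_sum_tcD, sStarD_eq_sum_tcD, Finset.sum_union h]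

/-- `sStarD` with first slot `Y` as a sum of marginal values. [this work] -/
theorem sStarD_eq_sum_yProfile_first (Y B C : Finset (Pd d)) : sStarD Y B C = ∑ y ∈ Y, yProfile B C y := by
  rw [sStarD_swap12, sStarD_swap23, sStarD_eq_sum_yProfile]

/-! ### F1 at lexicographic minimisers -/

namespace IsLexMin

variable {A B C : Finset (Pd d)}

/-- An addable cell never sits at the LOW level of an invariant pair of `A`: otherwise its swap partner, strictly above it, would be in
`A` and invariance would put the cell itself in `A`. [this work] -/
theorem apply_ne_lo_of_insert {x : Pd d} (hx : x ∉ A)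
    (hadd : IsUpperSet ((insert x A : Finset (Pd d)) : Set (Pd d))) {b : Fin d} {jb : Fin 2} (hAinv : AxInv b (lo jb) (hi jb) A) :
    x b ≠ lo jb := by
  intro hxb
  have hlt : x ≤ Function.update x b (hi jb) := le_update_hi_of_eq_lo hxb
  have hne : Function.update x b (hi jb) ≠ x := by
    intro heq; have := congrFun heq b; rw [Function.update_self, hxb] at this; exact lo_ne_hi jb this.symm
  have hmem : Function.update x b (hi jb) ∈ insert x A := hadd hlt (by rw [Finset.mem_coe]; exact mem_insert_self x A)
  rcases mem_insert.1 hmem with heq | hA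
  · exact hne heq
  · have : x ∈ A := by
      rw [hAinv x, axSwap_eq_update_of_eq_left hxb]; exact hA
    exact hx this

/-- **F1-EXTREMALITY.**  At a lexicographic minimiser every addable cell of `A` (a cell `x ∉ A` with `insert x A` an up-set) lies in
`B ∩ C`. [this work] -/
theorem mem_inter_of_insert (h : IsLexMin A B C) {x : Pd d} (hx : x ∉ A)
    (hadd : IsUpperSet ((insert x A : Finset (Pd d)) : Set (Pd d))) : x ∈ B ∩ C := by
  by_contra hxBC
  have hA := h.isUpperSet₁; have hB := h.isUpperSet₂; have hC := h.isUpperSet₃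
  -- a chosen invariant pair on every resolved axis
  have hj : ∀ b : Fin d, ∃ jb : Fin 2, Resolved b A B C →
      AxInv b (lo jb) (hi jb) A ∧ AxInv b (lo jb) (hi jb) B ∧ AxInv b (lo jb) (hi jb) C := by
    intro b
    by_cases hb : Resolved b A B C
    · obtain ⟨jb, h1, h2, h3⟩ := hb; exact ⟨jb, fun _ => ⟨h1, h2, h3⟩⟩
    · exact ⟨0, fun h' => absurd h' hb⟩
  choose j hjspec using hj
  set R : Finset (Fin d) := univ.filter fun b => Resolved b A B C with hR
  set L : Finset (Fin d) := R.filter fun b => x b = hi (j b) with hL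
  have hLR : L ⊆ R := filter_subset _ _
  have hRres : ∀ b ∈ R, Resolved b A B C := fun b hb => (mem_filter.1 hb).2
  have hxL : ∀ b ∈ L, x b = hi (j b) := fun b hb => (mem_filter.1 hb).2
  have hinvA : ∀ b ∈ L, AxInv b (lo (j b)) (hi (j b)) A := fun b hb => (hjspec b (hRres b (hLR hb))).1
  have hinvBC : ∀ b ∈ L, AxInv b (lo (j b)) (hi (j b)) (B ∩ C) := fun b hb =>
    axInv_inter (hjspec b (hRres b (hLR hb))).2.1 (hjspec b (hRres b (hLR hb))).2.2
  -- the augmented triple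
  set O := lowerOrbit j L x with hO
  have hdisj : Disjoint A O := disjoint_lowerOrbit hx hinvA hxL
  have hup : IsUpperSet ((A ∪ O : Finset (Pd d)) : Set (Pd d)) := isUpperSet_union_lowerOrbit hA hadd hinvA hxL
  -- (1) the functional does not increase: every orbit point is outside `B ∩ C`
  have hval : sStarD (A ∪ O) B C ≤ sStarD A B C := by
    rw [sStarD_union_first hdisj, sStarD_eq_sum_yProfile_first O]
    have : ∑ y ∈ O, yProfile B C y ≤ 0 := by
      refine Finset.sum_nonpos fun y hy => yProfile_nonpos_of_not_mem hB hC ?_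
      obtain ⟨T, hTL, rfl⟩ := mem_lowerOrbit.1 hy
      exact fun hmem => hxBC ((mem_iff_lowerOn_mem T (fun b hb => hinvBC b (hTL hb)) (fun b hb => hxL b (hTL hb))).2 hmem)
    linarith
  have heq : sStarD (A ∪ O) B C = sStarD A B C := le_antisymm hval (h.sStarD_le hup hB hC)
  -- (2) resolved axes stay resolved, so the unresolved count does not increase
  have hres : ∀ b, Resolved b A B C → Resolved b (A ∪ O) B C := by
    intro b hb
    have hbR : b ∈ R := mem_filter.2 ⟨mem_univ b, hb⟩
    obtain ⟨h1, h2, h3⟩ := hjspec b hb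
    refine ⟨j b, axInv_union h1 (axInv_lowerOrbit hxL b ?_), h2, h3⟩
    by_cases hxb : x b = hi (j b)
    · exact Or.inl (mem_filter.2 ⟨hbR, hxb⟩)
    · exact Or.inr ⟨apply_ne_lo_of_insert hx hadd h1, hxb⟩
  have hcount : unresCount (A ∪ O) B C ≤ unresCount A B C := by
    unfold unresCount
    exact card_le_card fun b hb => by
      simp only [mem_filter, mem_univ, true_and] at hb ⊢
      exact fun hres' => hb (hres b hres')
  have hcount' : unresCount A B C ≤ unresCount (A ∪ O) B C := h.2.2.2.2.1 _ _ _ hup hB hC heq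
  have hceq : unresCount (A ∪ O) B C = unresCount A B C := le_antisymm hcount hcount'
  -- (3) but the size went up
  have hsize := h.2.2.2.2.2 _ _ _ hup hB hC heq hceq
  have hcard : (A ∪ O).card = A.card + O.card := card_union_of_disjoint hdisj
  have hOpos : 0 < O.card := card_pos.2 ⟨x, self_mem_lowerOrbit j L x⟩
  omega

end IsLexMin

end Summit.CriticalPhenomena.PercolationContinuityZ3.Theorems.SahiGridPattern
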